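import Mathlib
import Summits.ResolutionOfSingularities.ResolutionOfSingularities.Theorems.WeightedInvariantLocalWeightedDropNCResCurveGraphClose
import Summits.ResolutionOfSingularities.ResolutionOfSingularities.Theorems.WeightedInvariantLocalWeightedDropNCDirectrixCutHist

/-!
# `WeightedInvariant.LocalWeightedDrop`, line `directrix-cut` (res-L1-w43-strat-1 g8/g9, target `stub_wildWideApexFourStartsWon`, v32/v33 W′|₄):
# the line stub LC `ApexLineCurveExit k m` DISCHARGED in every dimension `m ≥ 1` (S-E1-CURVE is dimension-free)

Crux item stmt-ResolutionOfSingularities-8899 `LocalWeightedDrop` (route `ResolutionOfSingularities/WeightedInvariant`), ENGINE skeleton v33; the line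
`directrix-cut` (`…NCDirectrixCutHist`: `ApexLineCurveExit`, strat-1's stub LC `stub_apexLineCurveThree : ∀ p prime k …, ApexLineCurveExit k 3`).
[OURS · L1 W4.3 · chain w43 · seat res-L1-w43-stub-1 gen 6; def-free; nothing here is a statement of any manuscript; AI-produced, gate-checked, weaker
than expert review.]

* **`apexLineCurveExit_of_pos`** — `ApexLineCurveExit k m` for every field with infinitely many elements and every `m ≥ 1`: the apex-column theorem
  `GraphCurve.dWinsTo_headDrop_of_hCol` (…NCResCurveGraphClose, p545735: E0 / S-E1 isolated (res-type-056) / the graph-curve loop with res-type-056's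
  entry) needs neither `O = ∅` nor the curve hypothesis.
* **`apexLineCurveExit_three`** — the text of strat-1's stub LC (`m = 3`, `∀ p prime, ∀ k [Field k] [CharP k p] [IsAlgClosed k]`).
-/

set_option linter.dupNamespace false -- mandated namespace of this single-conjunct summit

noncomputable section

namespace Summit.ResolutionOfSingularities.ResolutionOfSingularities.Theorems

namespace TameFourTupleDrop

open MvPowerSeries Literature.AlgebraicGeometry.Resolution

/-- **THE LINE STUB LC IN EVERY DIMENSION**: `ApexLineCurveExit k m` for `k` infinite and `m ≥ 1`. -/
theorem apexLineCurveExit_of_pos (k : Type) [Field k] [Infinite k] {m : ℕ} (hm : 0 < m) : ApexLineCurveExit k m := by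
  intro b δ hadm ho _ _ hcol _
  exact (GraphCurve.dWinsTo_headDrop_of_hCol hm hadm ho hcol).mono fun τ hτ => Or.inr hτ

/-- **strat-1's stub LC (`stub_apexLineCurveThree`) — its text, proved**: `∀ p prime, ∀ k [Field k] [CharP k p] [IsAlgClosed k], ApexLineCurveExit k 3`. -/
theorem apexLineCurveExit_three : ∀ (p : ℕ), p.Prime → ∀ (k : Type) [Field k] [CharP k p] [IsAlgClosed k], ApexLineCurveExit k 3 :=
  fun _ _ k _ _ _ => apexLineCurveExit_of_pos k (by norm_num)

/-- The same at the surface dimension `m = 2` (for completeness; the TOT2-LINE regime (H) is `stub_regimeApexColumn`). -/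
theorem apexLineCurveExit_two : ∀ (p : ℕ), p.Prime → ∀ (k : Type) [Field k] [CharP k p] [IsAlgClosed k], ApexLineCurveExit k 2 :=
  fun _ _ k _ _ _ => apexLineCurveExit_of_pos k (by norm_num)

end TameFourTupleDrop

end Summit.ResolutionOfSingularities.ResolutionOfSingularities.Theorems

end
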